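import Summits.AnomalousDissipation.AnomalousDissipation.Theorems.KolmogorovPincerIncrementPincerTG
import Summits.AnomalousDissipation.AnomalousDissipation.Theorems.CellRoutesTaylorGreenForceRegularTG

/-!
# KolmogorovPincer — `_holds` links for the two PROVED binders of `closes`

The gate could not append the usual `theorem <Decl>_holds` links inside
`Theses/KolmogorovPincer.lean` (the proving modules import the route file). `HarnessLib.Audit.Tribunal.holdsProved`
recognises a proved `closes` binder ONLY through a theorem named `<Decl>_holds` / `<Decl>.holds`; without it the kernel
tribunal (D-0034 t0) treats `TaylorGreenForceRegularTG` and `IncrementPincerTG` as ATTACKED cruxes and, in tier full,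
`intro h; exact?` closes `H → <binder>` for every registered strong hypothesis `H`, producing the spurious eligibility
blockers `unbridged-hypothesis:EnsembleZerothLaw | BrueDeLellisQuestion22 | BrueDeLellisQuestion21` (lens-1 g64 advisory
run 2026-08-31T17:15Z, 173.5 s). These two aliases (no new mathematics) make both binders role "proved".
Proposal target: `Summits/AnomalousDissipation/AnomalousDissipation/Theorems/KolmogorovPincerHoldsLinks.lean`
(prefix `KolmogorovPincer` ⇒ auto-imported by `harness/cli/tribunal check` for this route). [folklore]
-/

namespace Summit.AnomalousDissipation.AnomalousDissipation.Theses.KolmogorovPincer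

/-- `IncrementPincerTG` (stmt-AnomalousDissipation-32241) holds — alias of the landed proof. [folklore] -/
theorem IncrementPincerTG_holds : IncrementPincerTG :=
  Theorems.KolmogorovPincerIncrementPincerTG.kolmogorovPincer_incrementPincerTG

/-- `TaylorGreenForceRegularTG` (stmt-AnomalousDissipation-24257) holds — alias of the landed proof. [folklore] -/
theorem TaylorGreenForceRegularTG_holds : TaylorGreenForceRegularTG :=
  Theorems.TaylorGreenForceRegular.kolmogorovPincer_taylorGreenForceRegularTG

end Summit.AnomalousDissipation.AnomalousDissipation.Theses.KolmogorovPincer
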